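import Literature.Computability.AlgebraicComplexity.QuantumFunctionalsSpectralPointOfSubadditive
import Literature.Computability.AlgebraicComplexity.QuantumFunctionalsDirectSumSubadditive
import HarnessLib

/-!
# The quantum functionals are universal spectral points (CVZ Cor. 3.31): discharge of
# `ChristandlVranaZuiddam2023_universalSpectralPoint`

Topic `Literature/Computability/AlgebraicComplexity`; proofs file (theorems only) closing the named
fact `ChristandlVranaZuiddam2023_universalSpectralPoint` of `QuantumFunctionals.lean`: for every
`θ ∈ P([3])` the quantum functional `F_θ = quantumFunctional θ` of M. Christandl, P. Vrana, J. Zuiddam,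
*Universal points in the asymptotic spectrum of tensors*, J. Amer. Math. Soc. 36 (2023) 31–79 =
arXiv:1709.07851v3, **Cor. 3.31** (case `k = 3`, where `P_s(B) = P([3])`), is a universal spectral
point: `F_θ(⟨r⟩) = r`, `F_θ(s ⊕ t) = F_θ(s) + F_θ(t)`, `F_θ(s ⊗ t) = F_θ(s) F_θ(t)`, and
`s ≥ t ⇒ F_θ(s) ≥ F_θ(t)`, for all complex 3-tensors on finite index types.

The printed proof is now entirely in the tree; this file assembles it through the one-hypothesis
reduction `ChristandlVranaZuiddam2023_universalSpectralPoint_of_upper_subadditive`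
(`QuantumFunctionalsSpectralPointOfSubadditive.lean`: Cor. 3.31 from Lemma 3.11, given the proved
normalisation Thm. 3.19.1, super-additivity Lemma 3.22, super-multiplicativity Lemma 3.23,
monotonicity Lemma 3.20 / Thm. 3.19.4, sub-multiplicativity Lemma 3.13 and `E^θ = E_θ` Thm. 3.30)
and the discharge of Lemma 3.11, `ChristandlVranaZuiddam2023_upper_subadditive_holds`
(`QuantumFunctionalsDirectSumSubadditive.lean`).

No definitions, no named facts.

## References

* M. Christandl, P. Vrana, J. Zuiddam, J. Amer. Math. Soc. 36 (2023) 31–79 = arXiv:1709.07851v3,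
  Thm. 3.19, Lemma 3.11, Lemma 3.13, Lemma 3.20, Lemma 3.22, Lemma 3.23, Thm. 3.30, Cor. 3.31.
  [ChristandlVranaZuiddam2023]
-/

noncomputable section

namespace Literature.Computability.AlgebraicComplexity

universe u

/-- **Discharge of `ChristandlVranaZuiddam2023_universalSpectralPoint` (CVZ Cor. 3.31, `k = 3`).**
For every `θ ∈ P([3])`, `F_θ` is normalised on unit tensors, additive under `⊕`, multiplicative
under `⊗` and monotone under restriction on complex 3-tensors.
[cite: ChristandlVranaZuiddam2023, Cor. 3.31] -/
theorem ChristandlVranaZuiddam2023_universalSpectralPoint_holds :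
    ChristandlVranaZuiddam2023_universalSpectralPoint.{u} :=
  ChristandlVranaZuiddam2023_universalSpectralPoint_of_upper_subadditive
    ChristandlVranaZuiddam2023_upper_subadditive_holds

end Literature.Computability.AlgebraicComplexity

end
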